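import Summits.ResolutionOfSingularities.ResolutionOfSingularities.Theorems.PurelyInseparableDim4JointHereditaryCertCharts
import HarnessLib

/-!
# Purely inseparable four-folds: COMPUTATIONS for the first ESCAPING-CHILD certificate of the v4 atlas chain (brick S3 (c) v4,
# tranche 1, brick A6-computations; cell `res-dim4-pi`)

[OURS · counted 0] (D-0157 DOOR 2; host item stmt-ResolutionOfSingularities-16155, helper). Nothing here proves resolution of
singularities in dimension ≥ 4 / characteristic `p`. Model computations (no schemes) for the instance
`F = x₁^{2p} x₄ + x₂^{2p} x₃ + x₁ x₂^{p−1} x₃^p` (`p ≥ 3`; indices `0..3` below) with root host `V(z, x₁, x₂)` (`S = {0,1}`) and the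
LINEAR ESCAPING child `(0, 0, {0,2})`: the root charts `F₀ = y₁^p y₄ + y₁^p y₂^{2p} y₃ + y₂^{p−1} y₃^p` (chart `x₁`, state of the main
reading, centre `{0,2}`) and `F₁ = y₁^{2p} y₂^p y₄ + y₂^p y₃ + y₁ y₃^p` (chart `x₂`, state of the extra reading, centre `{1,2}`), their
cleanness and permissibility, the four DEAD second charts, the classification of the equimultiple pairs of the root charts
(`b₃ = 0`, i.e. on the child), and the root locus `x₁ = x₂ = 0`.

AI-produced formalisation, weaker than expert review. bears_on: LADDER-RESOLUTION:D157-DOOR2 (res-dim4-pi · S3 (c) v4 A6 computations).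
-/

set_option linter.dupNamespace false -- D-0017: single-problem summit path `Summit.<S>.<S>.…` by design

noncomputable section

open MvPolynomial Finset

namespace Summit.ResolutionOfSingularities.ResolutionOfSingularities.Theorems.PIDim4

open Literature.AlgebraicGeometry.Resolution
open Literature.AlgebraicGeometry.Resolution.Hauser2010

namespace Equimultiple

section ACertComputations

variable {K : Type} [Field K] {p : ℕ} [hp : Fact p.Prime] [CharP K p]

omit hp [CharP K p] in
/-- Chart `y₂` of the blow-up of `V(y₂, y₃)`. [cite: HauserPerlega2019PRIMS, §2 (the x₁-chart)] -/
theorem chartExponent_R1_four (a b c d : ℕ) :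
    CentreBlowup.chartExponent p ({1, 2} : Finset (Fin 4)) 1
        (Finsupp.single 0 a + Finsupp.single 1 b + Finsupp.single 2 c + Finsupp.single 3 d) =
      Finsupp.single 0 a + Finsupp.single 1 (b + c - p) + Finsupp.single 2 c + Finsupp.single 3 d := by
  ext i; fin_cases i <;> simp [CentreBlowup.chartExponent, Finsupp.update_apply, CentreBlowup.degIn_pair]

omit hp [CharP K p] in
/-- Chart `y₃` of the blow-up of `V(y₂, y₃)`. [cite: HauserPerlega2019PRIMS, §2 (the x₁-chart)] -/
theorem chartExponent_R2_four (a b c d : ℕ) :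
    CentreBlowup.chartExponent p ({1, 2} : Finset (Fin 4)) 2
        (Finsupp.single 0 a + Finsupp.single 1 b + Finsupp.single 2 c + Finsupp.single 3 d) =
      Finsupp.single 0 a + Finsupp.single 1 b + Finsupp.single 2 (b + c - p) + Finsupp.single 3 d := by
  ext i; fin_cases i <;> simp [CentreBlowup.chartExponent, Finsupp.update_apply, CentreBlowup.degIn_pair]

omit hp [CharP K p] in
/-- `F` in four-exponent form. [folklore] -/
theorem acert_eq :
    (X 0 ^ (2 * p) * X 3 + X 1 ^ (2 * p) * X 2 + X 0 * X 1 ^ (p - 1) * X 2 ^ p : MvPolynomial (Fin 4) K) =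
      C 1 * (X 0 ^ (2 * p) * X 1 ^ 0 * X 2 ^ 0 * X 3 ^ 1) + C 1 * (X 0 ^ 0 * X 1 ^ (2 * p) * X 2 ^ 1 * X 3 ^ 0) +
        C 1 * (X 0 ^ 1 * X 1 ^ (p - 1) * X 2 ^ p * X 3 ^ 0) := by
  simp only [pow_zero, pow_one, mul_one, one_mul, C_1]

omit [CharP K p] in
/-- **Root chart `x₁`**: `F ↦ F₀ = y₁^p y₄ + y₁^p y₂^{2p} y₃ + y₂^{p−1} y₃^p`. [cite: HauserPerlega2019PRIMS, §2 (the x₁-chart)] -/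
theorem chartTransform_S0_acert :
    CentreBlowup.chartTransform p ({0, 1} : Finset (Fin 4)) 0
        (X 0 ^ (2 * p) * X 3 + X 1 ^ (2 * p) * X 2 + X 0 * X 1 ^ (p - 1) * X 2 ^ p : MvPolynomial (Fin 4) K) =
      C 1 * (X 0 ^ p * X 1 ^ 0 * X 2 ^ 0 * X 3 ^ 1) + C 1 * (X 0 ^ p * X 1 ^ (2 * p) * X 2 ^ 1 * X 3 ^ 0) +
        C 1 * (X 0 ^ 0 * X 1 ^ (p - 1) * X 2 ^ p * X 3 ^ 0) := by
  have hp1 : 1 ≤ p := hp.out.one_lt.le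
  rw [acert_eq]
  simp only [C_mul_X_pow_four, CentreBlowup.chartTransform_add, CentreBlowup.chartTransform_monomial, chartExponent_S0_four]
  rw [show 2 * p + 0 - p = p by omega, show 0 + 2 * p - p = p by omega, show 1 + (p - 1) - p = 0 by omega]

omit [CharP K p] in
/-- **Root chart `x₂`**: `F ↦ F₁ = y₁^{2p} y₂^p y₄ + y₂^p y₃ + y₁ y₃^p`. [cite: HauserPerlega2019PRIMS, §2 (the x₁-chart)] -/
theorem chartTransform_S1_acert :
    CentreBlowup.chartTransform p ({0, 1} : Finset (Fin 4)) 1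
        (X 0 ^ (2 * p) * X 3 + X 1 ^ (2 * p) * X 2 + X 0 * X 1 ^ (p - 1) * X 2 ^ p : MvPolynomial (Fin 4) K) =
      C 1 * (X 0 ^ (2 * p) * X 1 ^ p * X 2 ^ 0 * X 3 ^ 1) + C 1 * (X 0 ^ 0 * X 1 ^ p * X 2 ^ 1 * X 3 ^ 0) +
        C 1 * (X 0 ^ 1 * X 1 ^ 0 * X 2 ^ p * X 3 ^ 0) := by
  have hp1 : 1 ≤ p := hp.out.one_lt.le
  rw [acert_eq]
  simp only [C_mul_X_pow_four, CentreBlowup.chartTransform_add, CentreBlowup.chartTransform_monomial, chartExponent_S1_four]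
  rw [show 2 * p + 0 - p = p by omega, show 0 + 2 * p - p = p by omega, show 1 + (p - 1) - p = 0 by omega]

omit hp [CharP K p] in
/-- **Second chart `{0,2}`/`y₁` of `F₀`**: `y₄ + y₁ y₂^{2p} y₃ + y₂^{p−1} y₃^p`. [cite: HauserPerlega2019PRIMS, §2] -/
theorem chartTransform_T0_acert :
    CentreBlowup.chartTransform p ({0, 2} : Finset (Fin 4)) 0
        (C 1 * (X 0 ^ p * X 1 ^ 0 * X 2 ^ 0 * X 3 ^ 1) + C 1 * (X 0 ^ p * X 1 ^ (2 * p) * X 2 ^ 1 * X 3 ^ 0) +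
          C 1 * (X 0 ^ 0 * X 1 ^ (p - 1) * X 2 ^ p * X 3 ^ 0) : MvPolynomial (Fin 4) K) =
      C 1 * (X 0 ^ 0 * X 1 ^ 0 * X 2 ^ 0 * X 3 ^ 1) + C 1 * (X 0 ^ 1 * X 1 ^ (2 * p) * X 2 ^ 1 * X 3 ^ 0) +
        C 1 * (X 0 ^ 0 * X 1 ^ (p - 1) * X 2 ^ p * X 3 ^ 0) := by
  simp only [C_mul_X_pow_four, CentreBlowup.chartTransform_add, CentreBlowup.chartTransform_monomial, chartExponent_T0_four]
  rw [show p + 0 - p = 0 by omega, show p + 1 - p = 1 by omega, show 0 + p - p = 0 by omega]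

omit hp [CharP K p] in
/-- **Second chart `{0,2}`/`y₃` of `F₀`**: `y₁^p y₄ + y₁^p y₂^{2p} y₃ + y₂^{p−1}`. [cite: HauserPerlega2019PRIMS, §2] -/
theorem chartTransform_T2_acert :
    CentreBlowup.chartTransform p ({0, 2} : Finset (Fin 4)) 2
        (C 1 * (X 0 ^ p * X 1 ^ 0 * X 2 ^ 0 * X 3 ^ 1) + C 1 * (X 0 ^ p * X 1 ^ (2 * p) * X 2 ^ 1 * X 3 ^ 0) +
          C 1 * (X 0 ^ 0 * X 1 ^ (p - 1) * X 2 ^ p * X 3 ^ 0) : MvPolynomial (Fin 4) K) =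
      C 1 * (X 0 ^ p * X 1 ^ 0 * X 2 ^ 0 * X 3 ^ 1) + C 1 * (X 0 ^ p * X 1 ^ (2 * p) * X 2 ^ 1 * X 3 ^ 0) +
        C 1 * (X 0 ^ 0 * X 1 ^ (p - 1) * X 2 ^ 0 * X 3 ^ 0) := by
  simp only [C_mul_X_pow_four, CentreBlowup.chartTransform_add, CentreBlowup.chartTransform_monomial, chartExponent_T2_four]
  rw [show p + 0 - p = 0 by omega, show p + 1 - p = 1 by omega, show 0 + p - p = 0 by omega]

omit hp [CharP K p] in
/-- **Second chart `{1,2}`/`y₂` of `F₁`**: `y₁^{2p} y₄ + y₂ y₃ + y₁ y₃^p`. [cite: HauserPerlega2019PRIMS, §2] -/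
theorem chartTransform_R1_acert :
    CentreBlowup.chartTransform p ({1, 2} : Finset (Fin 4)) 1
        (C 1 * (X 0 ^ (2 * p) * X 1 ^ p * X 2 ^ 0 * X 3 ^ 1) + C 1 * (X 0 ^ 0 * X 1 ^ p * X 2 ^ 1 * X 3 ^ 0) +
          C 1 * (X 0 ^ 1 * X 1 ^ 0 * X 2 ^ p * X 3 ^ 0) : MvPolynomial (Fin 4) K) =
      C 1 * (X 0 ^ (2 * p) * X 1 ^ 0 * X 2 ^ 0 * X 3 ^ 1) + C 1 * (X 0 ^ 0 * X 1 ^ 1 * X 2 ^ 1 * X 3 ^ 0) +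
        C 1 * (X 0 ^ 1 * X 1 ^ 0 * X 2 ^ p * X 3 ^ 0) := by
  simp only [C_mul_X_pow_four, CentreBlowup.chartTransform_add, CentreBlowup.chartTransform_monomial, chartExponent_R1_four]
  rw [show p + 0 - p = 0 by omega, show p + 1 - p = 1 by omega, show 0 + p - p = 0 by omega]

omit hp [CharP K p] in
/-- **Second chart `{1,2}`/`y₃` of `F₁`**: `y₁^{2p} y₂^p y₄ + y₂^p y₃ + y₁`. [cite: HauserPerlega2019PRIMS, §2] -/
theorem chartTransform_R2_acert :
    CentreBlowup.chartTransform p ({1, 2} : Finset (Fin 4)) 2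
        (C 1 * (X 0 ^ (2 * p) * X 1 ^ p * X 2 ^ 0 * X 3 ^ 1) + C 1 * (X 0 ^ 0 * X 1 ^ p * X 2 ^ 1 * X 3 ^ 0) +
          C 1 * (X 0 ^ 1 * X 1 ^ 0 * X 2 ^ p * X 3 ^ 0) : MvPolynomial (Fin 4) K) =
      C 1 * (X 0 ^ (2 * p) * X 1 ^ p * X 2 ^ 0 * X 3 ^ 1) + C 1 * (X 0 ^ 0 * X 1 ^ p * X 2 ^ 1 * X 3 ^ 0) +
        C 1 * (X 0 ^ 1 * X 1 ^ 0 * X 2 ^ 0 * X 3 ^ 0) := by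
  simp only [C_mul_X_pow_four, CentreBlowup.chartTransform_add, CentreBlowup.chartTransform_monomial, chartExponent_R2_four]
  rw [show p + 0 - p = 0 by omega, show p + 1 - p = 1 by omega, show 0 + p - p = 0 by omega]

omit hp [CharP K p] in
/-- Cleanness of a sum of three four-exponent monomials from one exponent `1` or `p ± 1`-type witness per monomial. [folklore] -/
theorem isClean_three_of_witness {a₁ b₁ c₁ d₁ a₂ b₂ c₂ d₂ a₃ b₃ c₃ d₃ : ℕ}
    (h₁ : ∃ i : Fin 4, ¬ p ∣ (Finsupp.single 0 a₁ + Finsupp.single 1 b₁ + Finsupp.single 2 c₁ + Finsupp.single 3 d₁ : Fin 4 →₀ ℕ) i)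
    (h₂ : ∃ i : Fin 4, ¬ p ∣ (Finsupp.single 0 a₂ + Finsupp.single 1 b₂ + Finsupp.single 2 c₂ + Finsupp.single 3 d₂ : Fin 4 →₀ ℕ) i)
    (h₃ : ∃ i : Fin 4, ¬ p ∣ (Finsupp.single 0 a₃ + Finsupp.single 1 b₃ + Finsupp.single 2 c₃ + Finsupp.single 3 d₃ : Fin 4 →₀ ℕ) i) :
    Literature.Barriers.ResolutionOfSingularities.HauserPerlega.IsClean p
      (C 1 * (X 0 ^ a₁ * X 1 ^ b₁ * X 2 ^ c₁ * X 3 ^ d₁) + C 1 * (X 0 ^ a₂ * X 1 ^ b₂ * X 2 ^ c₂ * X 3 ^ d₂) +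
        C 1 * (X 0 ^ a₃ * X 1 ^ b₃ * X 2 ^ c₃ * X 3 ^ d₃) : MvPolynomial (Fin 4) K) := by
  intro d hd hpth
  have key : ∀ i : Fin 4, ¬ p ∣ d i → False := fun i hi => by
    by_cases h0 : d i = 0
    · exact hi (h0 ▸ dvd_zero p)
    · exact hi (hpth i (Finsupp.mem_support_iff.mpr h0))
  rcases mem_support_three hd with rfl | rfl | rfl
  · obtain ⟨i, hi⟩ := h₁; exact key i hi
  · obtain ⟨i, hi⟩ := h₂; exact key i hi
  · obtain ⟨i, hi⟩ := h₃; exact key i hi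

omit hp [CharP K p] in
/-- `p ∤ 1` for `p ≥ 2`. [folklore] -/
theorem not_dvd_one_of_two_le (hp2 : 2 ≤ p) : ¬ p ∣ 1 := fun h => by
  have := Nat.le_of_dvd one_pos h; omega

omit hp [CharP K p] in
/-- `p ∤ p − 1` for `p ≥ 2`. [folklore] -/
theorem not_dvd_pred_of_two_le (hp2 : 2 ≤ p) : ¬ p ∣ (p - 1) := fun h => by
  have := Nat.le_of_dvd (by omega) h; omega

omit hp [CharP K p] in
/-- **`F` is clean.** [cite: HauserPerlega2019PRIMS, §2 (cleaning)] -/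
theorem isClean_acert (hp2 : 2 ≤ p) :
    Literature.Barriers.ResolutionOfSingularities.HauserPerlega.IsClean p
      (X 0 ^ (2 * p) * X 3 + X 1 ^ (2 * p) * X 2 + X 0 * X 1 ^ (p - 1) * X 2 ^ p : MvPolynomial (Fin 4) K) := by
  rw [acert_eq]
  exact isClean_three_of_witness ⟨3, by simpa using not_dvd_one_of_two_le hp2⟩ ⟨2, by simpa using not_dvd_one_of_two_le hp2⟩
    ⟨0, by simpa using not_dvd_one_of_two_le hp2⟩

omit hp [CharP K p] in
/-- **`F₀` is clean.** [cite: HauserPerlega2019PRIMS, §2 (cleaning)] -/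
theorem isClean_F0_acert (hp2 : 2 ≤ p) :
    Literature.Barriers.ResolutionOfSingularities.HauserPerlega.IsClean p
      (C 1 * (X 0 ^ p * X 1 ^ 0 * X 2 ^ 0 * X 3 ^ 1) + C 1 * (X 0 ^ p * X 1 ^ (2 * p) * X 2 ^ 1 * X 3 ^ 0) +
        C 1 * (X 0 ^ 0 * X 1 ^ (p - 1) * X 2 ^ p * X 3 ^ 0) : MvPolynomial (Fin 4) K) :=
  isClean_three_of_witness ⟨3, by simpa using not_dvd_one_of_two_le hp2⟩ ⟨2, by simpa using not_dvd_one_of_two_le hp2⟩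
    ⟨1, by simpa using not_dvd_pred_of_two_le hp2⟩

omit hp [CharP K p] in
/-- **`F₁` is clean.** [cite: HauserPerlega2019PRIMS, §2 (cleaning)] -/
theorem isClean_F1_acert (hp2 : 2 ≤ p) :
    Literature.Barriers.ResolutionOfSingularities.HauserPerlega.IsClean p
      (C 1 * (X 0 ^ (2 * p) * X 1 ^ p * X 2 ^ 0 * X 3 ^ 1) + C 1 * (X 0 ^ 0 * X 1 ^ p * X 2 ^ 1 * X 3 ^ 0) +
        C 1 * (X 0 ^ 1 * X 1 ^ 0 * X 2 ^ p * X 3 ^ 0) : MvPolynomial (Fin 4) K) :=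
  isClean_three_of_witness ⟨3, by simpa using not_dvd_one_of_two_le hp2⟩ ⟨2, by simpa using not_dvd_one_of_two_le hp2⟩
    ⟨0, by simpa using not_dvd_one_of_two_le hp2⟩

omit [CharP K p] in
/-- **`F ≠ 0`** (the coefficient of `x₁^{2p} x₄` is `1`). [folklore] -/
theorem acert_ne_zero :
    (X 0 ^ (2 * p) * X 3 + X 1 ^ (2 * p) * X 2 + X 0 * X 1 ^ (p - 1) * X 2 ^ p : MvPolynomial (Fin 4) K) ≠ 0 := by
  have hp0 : p ≠ 0 := hp.out.ne_zero
  intro h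
  have hc := congrArg (coeff (Finsupp.single (0 : Fin 4) (2 * p) + Finsupp.single 1 0 + Finsupp.single 2 0 +
    Finsupp.single 3 1)) h
  rw [acert_eq, C_mul_X_pow_four, C_mul_X_pow_four, C_mul_X_pow_four, coeff_add, coeff_add, coeff_monomial, coeff_monomial,
    coeff_monomial, if_pos rfl, if_neg, if_neg, coeff_zero] at hc
  · simp at hc
  · intro h'; have := DFunLike.congr_fun h' 3; simp at this
  · intro h'; have := DFunLike.congr_fun h' 3; simp at this

omit [CharP K p] in
/-- **`V(z, x₁, x₂)` is permissible for `z^p + F`.** [cite: HauserPerlega2019PRIMS, §2 (condition (1))] -/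
theorem isPermissibleCentre_S_acert :
    IsPermissibleCentre p ({0, 1} : Finset (Fin 4))
      (X 0 ^ (2 * p) * X 3 + X 1 ^ (2 * p) * X 2 + X 0 * X 1 ^ (p - 1) * X 2 ^ p : MvPolynomial (Fin 4) K) := by
  have hp1 : 1 ≤ p := hp.out.one_lt.le
  refine ⟨⟨0, by simp⟩, Finset.le_inf fun d hd => ?_⟩
  rw [acert_eq] at hd
  rcases mem_support_three hd with rfl | rfl | rfl <;>
    simp [CentreBlowup.degIn_pair (show (0 : Fin 4) ≠ 1 by decide)] <;> norm_cast <;> omega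

omit hp [CharP K p] in
/-- **`V(z, y₁, y₃)` is permissible for `z^p + F₀`** (the main reading of the child). [cite: HauserPerlega2019PRIMS, §2 (condition (1))] -/
theorem isPermissibleCentre_T_F0_acert :
    IsPermissibleCentre p ({0, 2} : Finset (Fin 4))
      (C 1 * (X 0 ^ p * X 1 ^ 0 * X 2 ^ 0 * X 3 ^ 1) + C 1 * (X 0 ^ p * X 1 ^ (2 * p) * X 2 ^ 1 * X 3 ^ 0) +
        C 1 * (X 0 ^ 0 * X 1 ^ (p - 1) * X 2 ^ p * X 3 ^ 0) : MvPolynomial (Fin 4) K) := by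
  refine ⟨⟨0, by simp⟩, Finset.le_inf fun d hd => ?_⟩
  rcases mem_support_three hd with rfl | rfl | rfl <;>
    simp [CentreBlowup.degIn_pair (show (0 : Fin 4) ≠ 2 by decide)]

omit hp [CharP K p] in
/-- **`V(z, y₂, y₃)` is permissible for `z^p + F₁`** (the extra reading of the child). [cite: HauserPerlega2019PRIMS, §2 (condition (1))] -/
theorem isPermissibleCentre_R_F1_acert :
    IsPermissibleCentre p ({1, 2} : Finset (Fin 4))
      (C 1 * (X 0 ^ (2 * p) * X 1 ^ p * X 2 ^ 0 * X 3 ^ 1) + C 1 * (X 0 ^ 0 * X 1 ^ p * X 2 ^ 1 * X 3 ^ 0) +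
        C 1 * (X 0 ^ 1 * X 1 ^ 0 * X 2 ^ p * X 3 ^ 0) : MvPolynomial (Fin 4) K) := by
  refine ⟨⟨1, by simp⟩, Finset.le_inf fun d hd => ?_⟩
  rcases mem_support_three hd with rfl | rfl | rfl <;>
    simp [CentreBlowup.degIn_pair (show (1 : Fin 4) ≠ 2 by decide)]

/-- **The root locus**: order `≥ 2 ≤ p` of `F(x + b)` forces `b₁ = b₂ = 0` (`∂₄ F = x₁^{2p}`, `∂₃ F = x₂^{2p} + p·…`).
[cite: Hauser2010, §F (equiconstant points)] -/
theorem roots_acert (b : Fin 4 → K)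
    (H : ∀ d : Fin 4 →₀ ℕ, d ≠ 0 → d.degree < p → coeff d (PointBlowup.translate b
      (X 0 ^ (2 * p) * X 3 + X 1 ^ (2 * p) * X 2 + X 0 * X 1 ^ (p - 1) * X 2 ^ p : MvPolynomial (Fin 4) K)) = 0) :
    b 0 = 0 ∧ b 1 = 0 := by
  have h2 := eval_pderiv_eq_zero_of_forall_coeff b _ H 2
  have h3 := eval_pderiv_eq_zero_of_forall_coeff b _ H 3
  simp [(pderiv (2 : Fin 4)).leibniz_pow, (pderiv (3 : Fin 4)).leibniz_pow] at h2 h3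
  exact ⟨h3.1, h2.1⟩

end ACertComputations

end Equimultiple

end Summit.ResolutionOfSingularities.ResolutionOfSingularities.Theorems.PIDim4

end
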